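import Mathlib
import Summits.Ventures.HodgeRepro.Statements

/-!
# The `μ`-table pairs the four lines by their SIGN at a mixed place (T3.2 / R-B.4: which lines have `κ_j = 0`)

Blind re-derivation cell `pub-hodge-repro`, Tier 3, seat `t3-p2` (prover-pub-hodge-repro-t3-p2-g3-0).  Target tree path
`lean/Summits/Ventures/HodgeRepro/Tier3SlotPairs.lean`.  Imports: Mathlib + the sealed `Statements.lean` (the `μ`-table
vocabulary `SeesawDatum`, `slotDelta`, `slotDelta₂`, `slotDelta₃`, `conjSwapAt`, `muSharp₂₃`).  Paper:
`proofs/t3-p2/T3-P2-NOTE-g3-KAPPA.md` §1–§3 (answer to the lead's question «which of the four lines have `κ_j = 0`»).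

## What this file proves (elementary unwinding of the cell's own definitions)

At an infinite place `w` of the CM field `L` write `0 < (w.embedding (S.a i)).re := 0 < re w(a_i)` for the sign of the `i`-th line.  A place is
MIXED for the plane `W = W₀ ⊕ W₁` when `a₀, a₁` have opposite signs (`slotDelta ≠ 0` there), and by the seesaw's equal
signatures (N1-sig, `T3SeesawSigns`) the second plane `W′ = W₂ ⊕ W₃` is then mixed too — taken here as the hypothesis
`hW′`.

* `muSharp₂₃_zero`, `muSharp₂₃_one`, `muSharp₂₃_two`, `muSharp₂₃_three` — the four slots of the sharpened table:
  `μ(0)`, `μ(0) + δ_S`, `μ(0) + δ₂`, `μ(0) + δ₃`;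
* `slotDelta_ne_zero_iff` — `δ_S(w) ≠ 0` exactly at the mixed places of `W`;
* `conjSwapAt_iff_pos_three` — at a place mixed for both planes, the relabelling bit is set iff lines `0` and `3` have
  the same sign (iff lines `0` and `2` have opposite signs);
* **`muSharp₂₃_eq_of_sign`** — at a place mixed for both planes the exponent of EVERY line is a function of its sign:
  `slot j = μ(0) + (0 if sgn a_j = sgn a₀ else δ_S)`;  hence
* **`muSharp₂₃_eq_of_same_sign`** — two lines of the same sign at `w` have the same exponent (the two POSITIVE lines share
  one value, the two NEGATIVE lines share the other), and
* **`muSharp₂₃_pos_sub_neg`** — positive minus negative is `3·sgn(Im w(δ))`;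
* `abs_eq_one_xor_abs_eq_five` — integers `k₊, k₋ ∈ {±1, ±5}` with `k₊ − k₋ = ±6` have exactly one `|·| = 5`
  (so with `k_j = 2e_j − m` and ROUTE (9.3) exactly one line PER PLANE has `|k| = 5` at a mixed place, the two
  `|k| = 5` lines having the same sign);
* `exists_side_bit` — for either target sign there is a side bit `c ∈ {2, −2}` (`= m′ − m`) putting the lines of that sign
  on `|k| = 1`: the `κ`-pattern is a CHOICE of the endoscopic datum, not a datum of the face.

Nothing here says anything about the status of the Hodge conjecture for CM abelian varieties, which is NOT proved.
-/

set_option autoImplicit false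

namespace HodgeRepro.T3.SlotPairs

open Summit.Ventures.HodgeRepro.MuTable NumberField

variable {L : Type} [Field L] [NumberField L] [NumberField.IsCMField L]

/-- Slot `0` of the sharpened table is the slot-`0` entry of `μ` (the gauge). -/
theorem muSharp₂₃_zero (δ : L) (μ : Table L) (S : SeesawDatum L) (w : InfinitePlace L) :
    muSharp₂₃ δ μ S 0 w = μ S 0 w := by
  simp [muSharp₂₃, muSharp, Function.update_of_ne]

/-- Slot `1` of the sharpened table is `μ(0) + δ_S`. -/
theorem muSharp₂₃_one (δ : L) (μ : Table L) (S : SeesawDatum L) (w : InfinitePlace L) :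
    muSharp₂₃ δ μ S 1 w = μ S 0 w + slotDelta δ S w := by
  simp [muSharp₂₃, muSharp, Function.update_of_ne]

/-- Slot `2` of the sharpened table is `μ(0) + δ₂`. -/
theorem muSharp₂₃_two (δ : L) (μ : Table L) (S : SeesawDatum L) (w : InfinitePlace L) :
    muSharp₂₃ δ μ S 2 w = μ S 0 w + slotDelta₂ δ S w := by
  simp [muSharp₂₃, Function.update_of_ne]

/-- Slot `3` of the sharpened table is `μ(0) + δ₃`. -/
theorem muSharp₂₃_three (δ : L) (μ : Table L) (S : SeesawDatum L) (w : InfinitePlace L) :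
    muSharp₂₃ δ μ S 3 w = μ S 0 w + slotDelta₃ δ S w := by
  simp [muSharp₂₃]

/-- `δ_S(w) ≠ 0` exactly at the places where `a₀, a₁` have opposite signs (the mixed places of `W`). -/
theorem slotDelta_ne_zero_iff (δ : L) (S : SeesawDatum L) (w : InfinitePlace L) :
    slotDelta δ S w ≠ 0 ↔ ¬ (0 < (w.embedding (S.a 0)).re ↔ 0 < (w.embedding (S.a 1)).re) := by
  unfold slotDelta dW
  by_cases h : (0 < (w.embedding (S.a 0)).re ↔ 0 < (w.embedding (S.a 1)).re)
  · simp [h]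
  · simp only [Matrix.cons_val_zero, Matrix.cons_val_one, h, if_false, not_false_eq_true, iff_true]
    split_ifs <;> norm_num

/-- At a mixed place `δ_S(w) = (±1)·(±3)`: `+1` iff line `1` is the positive one, `+3` iff `0 < Im w(δ)`. -/
theorem slotDelta_of_mixed (δ : L) (S : SeesawDatum L) (w : InfinitePlace L) (h : ¬ (0 < (w.embedding (S.a 0)).re ↔ 0 < (w.embedding (S.a 1)).re)) :
    slotDelta δ S w = (if 0 < (w.embedding (S.a 1)).re then 1 else -1) * (if 0 < (w.embedding δ).im then 3 else -3) := by
  unfold slotDelta dW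
  simp only [Matrix.cons_val_zero, Matrix.cons_val_one, h, if_false]
  split_ifs <;> rfl

/-- At a place mixed for both planes, the relabelling bit (`a₀, a₂` of opposite signs) holds iff lines `0` and `3` have the
same sign. -/
theorem conjSwapAt_iff_pos_three (S : SeesawDatum L) (w : InfinitePlace L)
    (hW' : ¬ (0 < (w.embedding (S.a 2)).re ↔ 0 < (w.embedding (S.a 3)).re)) : conjSwapAt S w ↔ (0 < (w.embedding (S.a 0)).re ↔ 0 < (w.embedding (S.a 3)).re) := by
  unfold conjSwapAt dW dW'
  simp only [Matrix.cons_val_zero]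
  tauto

/-- **Exponents are a function of the sign.**  At a place mixed for both planes, slot `j` of the sharpened table equals
`μ(0)` if line `j` has the sign of line `0` and `μ(0) + δ_S` otherwise. -/
theorem muSharp₂₃_eq_of_sign (δ : L) (μ : Table L) (S : SeesawDatum L) (w : InfinitePlace L)
    (hW : ¬ (0 < (w.embedding (S.a 0)).re ↔ 0 < (w.embedding (S.a 1)).re)) (hW' : ¬ (0 < (w.embedding (S.a 2)).re ↔ 0 < (w.embedding (S.a 3)).re)) (j : Fin 4) :
    muSharp₂₃ δ μ S j w = μ S 0 w + (if (0 < (w.embedding (S.a 0)).re ↔ 0 < (w.embedding (S.a j)).re) then 0 else slotDelta δ S w) := by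
  have hbit : conjSwapAt S w ↔ (0 < (w.embedding (S.a 0)).re ↔ 0 < (w.embedding (S.a 3)).re) := conjSwapAt_iff_pos_three S w hW'
  have hbit2 : conjSwapAt S w ↔ ¬ (0 < (w.embedding (S.a 0)).re ↔ 0 < (w.embedding (S.a 2)).re) := by
    unfold conjSwapAt dW dW'; simp only [Matrix.cons_val_zero]
  match j with
  | 0 => simp [muSharp₂₃_zero]
  | 1 => rw [muSharp₂₃_one, if_neg hW]
  | 2 =>
    rw [muSharp₂₃_two]
    unfold slotDelta₂
    by_cases hc : conjSwapAt S w
    · have h2 : ¬ (0 < (w.embedding (S.a 0)).re ↔ 0 < (w.embedding (S.a 2)).re) := hbit2.mp hc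
      rw [if_pos hc, if_neg h2]
    · have h2 : (0 < (w.embedding (S.a 0)).re ↔ 0 < (w.embedding (S.a 2)).re) := by
        by_contra h; exact hc (hbit2.mpr h)
      rw [if_neg hc, if_pos h2]
  | 3 =>
    rw [muSharp₂₃_three]
    unfold slotDelta₃
    by_cases hc : conjSwapAt S w
    · have h3 : (0 < (w.embedding (S.a 0)).re ↔ 0 < (w.embedding (S.a 3)).re) := hbit.mp hc
      rw [if_pos hc, if_pos h3]
    · have h3 : ¬ (0 < (w.embedding (S.a 0)).re ↔ 0 < (w.embedding (S.a 3)).re) := by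
        intro h; exact hc (hbit.mpr h)
      rw [if_neg hc, if_neg h3]

/-- **Same sign, same exponent**: at a place mixed for both planes, two lines of the same sign have equal slots — the two
positive lines share one value and the two negative lines share the other. -/
theorem muSharp₂₃_eq_of_same_sign (δ : L) (μ : Table L) (S : SeesawDatum L) (w : InfinitePlace L)
    (hW : ¬ (0 < (w.embedding (S.a 0)).re ↔ 0 < (w.embedding (S.a 1)).re)) (hW' : ¬ (0 < (w.embedding (S.a 2)).re ↔ 0 < (w.embedding (S.a 3)).re)) (i j : Fin 4)
    (hij : 0 < (w.embedding (S.a i)).re ↔ 0 < (w.embedding (S.a j)).re) : muSharp₂₃ δ μ S i w = muSharp₂₃ δ μ S j w := by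
  rw [muSharp₂₃_eq_of_sign δ μ S w hW hW' i, muSharp₂₃_eq_of_sign δ μ S w hW hW' j]
  by_cases h : (0 < (w.embedding (S.a 0)).re ↔ 0 < (w.embedding (S.a i)).re)
  · have h' : (0 < (w.embedding (S.a 0)).re ↔ 0 < (w.embedding (S.a j)).re) := h.trans hij
    rw [if_pos h, if_pos h']
  · have h' : ¬ (0 < (w.embedding (S.a 0)).re ↔ 0 < (w.embedding (S.a j)).re) := fun h' => h (h'.trans hij.symm)
    rw [if_neg h, if_neg h']

/-- **Positive minus negative is `3·sgn(Im w(δ))`**: at a place mixed for both planes, if line `i` is positive and line `j`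
negative then `slot i − slot j = (if 0 < Im w(δ) then 3 else −3)`. -/
theorem muSharp₂₃_pos_sub_neg (δ : L) (μ : Table L) (S : SeesawDatum L) (w : InfinitePlace L)
    (hW : ¬ (0 < (w.embedding (S.a 0)).re ↔ 0 < (w.embedding (S.a 1)).re)) (hW' : ¬ (0 < (w.embedding (S.a 2)).re ↔ 0 < (w.embedding (S.a 3)).re)) (i j : Fin 4)
    (hi : 0 < (w.embedding (S.a i)).re) (hj : ¬ 0 < (w.embedding (S.a j)).re) :
    muSharp₂₃ δ μ S i w - muSharp₂₃ δ μ S j w = (if 0 < (w.embedding δ).im then 3 else -3) := by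
  rw [muSharp₂₃_eq_of_sign δ μ S w hW hW' i, muSharp₂₃_eq_of_sign δ μ S w hW hW' j,
    slotDelta_of_mixed δ S w hW]
  by_cases h0 : 0 < (w.embedding (S.a 0)).re
  · have h1 : ¬ 0 < (w.embedding (S.a 1)).re := fun h => hW ⟨fun _ => h, fun _ => h0⟩
    have hi' : (0 < (w.embedding (S.a 0)).re ↔ 0 < (w.embedding (S.a i)).re) := ⟨fun _ => hi, fun _ => h0⟩
    have hj' : ¬ (0 < (w.embedding (S.a 0)).re ↔ 0 < (w.embedding (S.a j)).re) := fun h => hj (h.mp h0)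
    rw [if_pos hi', if_neg hj', if_neg h1]
    split_ifs <;> ring
  · have h1 : 0 < (w.embedding (S.a 1)).re := by
      by_contra h; exact hW ⟨fun h' => absurd h' h0, fun h' => absurd h' h⟩
    have hi' : ¬ (0 < (w.embedding (S.a 0)).re ↔ 0 < (w.embedding (S.a i)).re) := fun h => h0 (h.mpr hi)
    have hj' : (0 < (w.embedding (S.a 0)).re ↔ 0 < (w.embedding (S.a j)).re) :=
      ⟨fun h => absurd h h0, fun h => absurd h hj⟩
    rw [if_neg hi', if_pos hj', if_pos h1]
    split_ifs <;> ring

/-- **One `|k| = 5` per pair.**  Integers `k₊, k₋ ∈ {±1, ±5}` with `k₊ − k₋ = ±6` (ROUTE (9.3): the admissible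
values at a mixed place) have exactly one member of absolute value `5`. -/
theorem abs_eq_one_xor_abs_eq_five (kp km : ℤ) (hp : kp = 1 ∨ kp = -1 ∨ kp = 5 ∨ kp = -5)
    (hm : km = 1 ∨ km = -1 ∨ km = 5 ∨ km = -5) (hd : kp - km = 6 ∨ kp - km = -6) :
    (|kp| = 5 ∧ |km| = 1) ∨ (|kp| = 1 ∧ |km| = 5) := by
  rcases hp with rfl | rfl | rfl | rfl <;> rcases hm with rfl | rfl | rfl | rfl <;> norm_num at hd <;> norm_num

/-- **The side bit is a choice.**  With `k₊ = c + 3ε`, `k₋ = c − 3ε` (`ε = sgn Im w(δ) = ±1`, `c = m′ − m ∈ {2, −2}`,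
ROUTE (9.3′) ∖ {0}), for EITHER target sign there is a `c` putting the lines of that sign on `|k| = 1`: `c = −2ε` makes
`|k₊| = 1` (and `|k₋| = 5`), `c = 2ε` makes `|k₋| = 1` (and `|k₊| = 5`). -/
theorem exists_side_bit (ε : ℤ) (hε : ε = 1 ∨ ε = -1) :
    (∃ c : ℤ, (c = 2 ∨ c = -2) ∧ |c + 3 * ε| = 1 ∧ |c - 3 * ε| = 5) ∧
    (∃ c : ℤ, (c = 2 ∨ c = -2) ∧ |c - 3 * ε| = 1 ∧ |c + 3 * ε| = 5) := by
  rcases hε with rfl | rfl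
  · exact ⟨⟨-2, by norm_num, by norm_num, by norm_num⟩, ⟨2, by norm_num, by norm_num, by norm_num⟩⟩
  · exact ⟨⟨2, by norm_num, by norm_num, by norm_num⟩, ⟨-2, by norm_num, by norm_num, by norm_num⟩⟩

end HodgeRepro.T3.SlotPairs
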